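import Summits.HubbardSuperconductivity.HubbardSuperconductivity.Theorems.AnisotropyChordTransferFibre3GresZeroSharp

/-!
# Route `AnisotropyChord` / H0 rotor rung: NUMERIC a-priori `ν`-RANGE of the ground two-magnon eigenvalue (`ν ≤ .0513` for `L ≥ 31`)

Quotable numeric corollaries of `…Fibre3GresZeroSharp` (`η_eff ≤ π²/(2πH_N − 3π + 81/10 + 2/N)`, `N = (L−1)/2`) for the
Level-2 / FIN boundary of the GM₃ ∀L certificate (LEVEL2-SPEC §2: cells in `ν = λ₂/θ²`, `θ = 2π/L`, up to `ν_max`;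
measured `ν_max(L₀ = 32) ≈ .045`):
* `harmonic_fifteen_gt`: `H₁₅ > 3.3182`, `harmonic_three`: `H₃ = 11/6`;
* ★★ `nu_le_of_ge_31`: **`λ₂ ≤ 0.0513·θ²`** (i.e. `ν ≤ .0513`, `η_eff ≤ .0513·π² < .507`) for the ground profile, every `L ≥ 31`, `0 ≤ Δ`;
* ★ `nu_le_of_ge_7`: **`λ₂ ≤ 0.0982·θ²`** for every `L ≥ 7`, `0 ≤ Δ` (the FIN range `8 ≤ L < 32`);
* `etaEff_le_of_ge_31`: `η_eff ≤ 0.507` (`L ≥ 31`).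
Prover seat `hubbard-h0-rotor-p1` g24; helper for stmt-HubbardSuperconductivity-19089 (`--supports`).
-/

set_option linter.dupNamespace false
set_option autoImplicit false

noncomputable section

open scoped BigOperators
open Complex

namespace Summit.HubbardSuperconductivity.HubbardSuperconductivity.Theorems.AnisotropyChord.Transfer.Fibre3

variable (L : ℕ) [NeZero L]

omit [NeZero L] in
/-- `H₁₅ > 3.3182` (`H₁₅ = 1195757/360360`). [folklore] -/
theorem harmonic_fifteen_gt : (33182 / 10000 : ℚ) < harmonic 15 := by
  simp only [harmonic, Finset.sum_range_succ, Finset.sum_range_zero]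
  norm_num

omit [NeZero L] in
/-- `H₃ = 11/6`. [folklore] -/
theorem harmonic_three : harmonic 3 = 11 / 6 := by
  simp only [harmonic, Finset.sum_range_succ, Finset.sum_range_zero]
  norm_num

/-- the generic step: a lower bound `B ≤ 2πH_N − 3π + 81/10 + 2/N` with `0 < B` turns `etaEff_le_sharp_harmonic` into
`λ₂ ≤ (1/B)·θ²`. [folklore] -/
theorem lam2_le_of_box_const (hL : 5 ≤ L) {Δ lam2 : ℝ} (hΔ : 0 ≤ Δ) {f : Tor L → ℝ}
    (hf : IsGroundTwoMagnon L Δ lam2 f) {B : ℝ} (hB : 0 < B)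
    (hle : B ≤ 2 * Real.pi * (harmonic ((L - 1) / 2) : ℝ) - 3 * Real.pi + 81 / 10 + 2 / ((((L - 1) / 2 : ℕ)) : ℝ)) :
    lam2 ≤ (1 / B) * (2 * Real.pi / L) ^ 2 := by
  have h := etaEff_le_sharp_harmonic L hL hΔ hf
  have hLpos : (0 : ℝ) < L := by exact_mod_cast (show 0 < L by omega)
  have hV : (0 : ℝ) < (L : ℝ) ^ 2 := by positivity
  have hπ : 0 < Real.pi ^ 2 := by positivity
  unfold etaEff at h
  have h2 : (L : ℝ) ^ 2 * lam2 / 4 ≤ Real.pi ^ 2 / B :=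
    h.trans (div_le_div_of_nonneg_left hπ.le hB hle)
  rw [div_le_iff₀ (by norm_num), div_mul_eq_mul_div, le_div_iff₀ hB] at h2
  have e : (1 / B) * (2 * Real.pi / L) ^ 2 = 4 * Real.pi ^ 2 / (B * (L : ℝ) ^ 2) := by
    field_simp
    ring
  rw [e, le_div_iff₀ (by positivity)]
  nlinarith

/-- ★★ **`ν ≤ .0513` for `L ≥ 31`:** `λ₂ ≤ 0.0513·(2π/L)²` for the ground two-magnon profile (`0 ≤ Δ`). [folklore] -/
theorem nu_le_of_ge_31 (hL : 31 ≤ L) {Δ lam2 : ℝ} (hΔ : 0 ≤ Δ) {f : Tor L → ℝ} (hf : IsGroundTwoMagnon L Δ lam2 f) :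
    lam2 ≤ 0.0513 * (2 * Real.pi / L) ^ 2 := by
  have hN : 15 ≤ (L - 1) / 2 := by omega
  have hH := Literature.NumberTheory.LFunctions.LagariasNumerical.harmonic_mono hN
  have hH15 := harmonic_fifteen_gt
  have hH' : (33182 / 10000 : ℝ) < (harmonic ((L - 1) / 2) : ℝ) := by
    have : ((33182 / 10000 : ℚ) : ℝ) < ((harmonic ((L - 1) / 2) : ℚ) : ℝ) := by exact_mod_cast hH15.trans_le hH
    push_cast at this
    exact this
  have hpi := Real.pi_gt_d6
  have hNpos : (0 : ℝ) < ((((L - 1) / 2 : ℕ)) : ℝ) := by exact_mod_cast (show 0 < (L - 1) / 2 by omega)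
  have h2N : 0 < 2 / ((((L - 1) / 2 : ℕ)) : ℝ) := by positivity
  -- `B := 1/0.0513 ≤ 2πH − 3π + 8.1 + 2/N`
  have hB : (1 / 0.0513 : ℝ) ≤ 2 * Real.pi * (harmonic ((L - 1) / 2) : ℝ) - 3 * Real.pi + 81 / 10
      + 2 / ((((L - 1) / 2 : ℕ)) : ℝ) := by
    nlinarith
  have h := lam2_le_of_box_const L (by omega) hΔ hf (by norm_num) hB
  have e : (1 / (1 / 0.0513) : ℝ) = 0.0513 := by norm_num
  rwa [e] at h

/-- ★ **`ν ≤ .0982` for `L ≥ 7`** (the FIN range): `λ₂ ≤ 0.0982·(2π/L)²` for the ground profile (`0 ≤ Δ`). [folklore] -/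
theorem nu_le_of_ge_7 (hL : 7 ≤ L) {Δ lam2 : ℝ} (hΔ : 0 ≤ Δ) {f : Tor L → ℝ} (hf : IsGroundTwoMagnon L Δ lam2 f) :
    lam2 ≤ 0.0982 * (2 * Real.pi / L) ^ 2 := by
  have hN : 3 ≤ (L - 1) / 2 := by omega
  have hH := Literature.NumberTheory.LFunctions.LagariasNumerical.harmonic_mono hN
  rw [harmonic_three] at hH
  have hH' : (11 / 6 : ℝ) ≤ (harmonic ((L - 1) / 2) : ℝ) := by
    have : ((11 / 6 : ℚ) : ℝ) ≤ ((harmonic ((L - 1) / 2) : ℚ) : ℝ) := by exact_mod_cast hH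
    push_cast at this
    exact this
  have hpi := Real.pi_gt_d6
  have hNpos : (0 : ℝ) < ((((L - 1) / 2 : ℕ)) : ℝ) := by exact_mod_cast (show 0 < (L - 1) / 2 by omega)
  have h2N : 0 < 2 / ((((L - 1) / 2 : ℕ)) : ℝ) := by positivity
  have hB : (1 / 0.0982 : ℝ) ≤ 2 * Real.pi * (harmonic ((L - 1) / 2) : ℝ) - 3 * Real.pi + 81 / 10
      + 2 / ((((L - 1) / 2 : ℕ)) : ℝ) := by
    nlinarith
  have h := lam2_le_of_box_const L (by omega) hΔ hf (by norm_num) hB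
  have e : (1 / (1 / 0.0982) : ℝ) = 0.0982 := by norm_num
  rwa [e] at h

/-- `η_eff ≤ 0.507` for `L ≥ 31` (`η_eff = Vλ₂/4 = π²ν`). [folklore] -/
theorem etaEff_le_of_ge_31 (hL : 31 ≤ L) {Δ lam2 : ℝ} (hΔ : 0 ≤ Δ) {f : Tor L → ℝ}
    (hf : IsGroundTwoMagnon L Δ lam2 f) : etaEff L lam2 ≤ 0.507 := by
  have h := nu_le_of_ge_31 L hL hΔ hf
  have hLpos : (0 : ℝ) < L := by exact_mod_cast (show 0 < L by omega)
  have hpi := Real.pi_lt_d6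
  have hpi0 := Real.pi_pos
  unfold etaEff
  have e : (L : ℝ) ^ 2 * (0.0513 * (2 * Real.pi / L) ^ 2) / 4 = 0.0513 * Real.pi ^ 2 := by
    field_simp
    ring
  calc (L : ℝ) ^ 2 * lam2 / 4 ≤ (L : ℝ) ^ 2 * (0.0513 * (2 * Real.pi / L) ^ 2) / 4 := by
        gcongr
    _ = 0.0513 * Real.pi ^ 2 := e
    _ ≤ 0.507 := by nlinarith

end Summit.HubbardSuperconductivity.HubbardSuperconductivity.Theorems.AnisotropyChord.Transfer.Fibre3

end
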